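import Summits.MatrixMultiplication.MatrixMultiplication.Theses.HyperbolicRankMethods
import Literature.Computability.AlgebraicComplexity.FlatteningBound

/-!
# MatrixMultiplication / HyperbolicRankMethods — support `HypSoundness`
(stmt-MatrixMultiplication-10090)

Elementary soundness of a sub-additive Gårding-rank measure for tensor rank.  For a real
homogeneous polynomial `h ∈ ℝ[x_1, …, x_N]` of degree `d` with `h(e) ≠ 0`, write
`Rank_h(w) := d − ord_{t=0} h(w + t e)` (in Lean: `d - natTrailingDegree` of
`MvPolynomial.aeval (fun i => C (w i) + C (e i) * X) h`).  If `Rank_h` is sub-additive on `ℝ^N`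
and `Rank_h (Φ x) ≤ k` for every rank-one tensor (triad) `x` and an `ℝ`-linear `Φ`, then
`Rank_h (Φ t) ≤ k · R(t)` for every tensor `t` over finite index types.

Proof (as in the route's item card P1 (iii)): `h(0 + t e) = h(e) t^d` by homogeneity, so
`Rank_h 0 = 0` (`aeval_C_mul_X_of_isHomogeneous`); write `t` as a sum of `R(t)` triads
(`exists_triad_decomposition_tensorRank`, the infimum is attained over finite index types),
push `Φ` through the sum and use sub-additivity (`Finset.le_sum_of_subadditive`).

References: the soundness half of every rank-method lower bound, e.g. Efremenko–Garg–Oliveira–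
Wigderson 2018 (§1.2, rank methods); Gurvits 2004 (hyperbolic rank); Bläser 2013, §4 (tensor rank).
-/

noncomputable section

open scoped BigOperators Polynomial

namespace Summit.MatrixMultiplication.MatrixMultiplication.Theorems

open Literature.Computability.AlgebraicComplexity

/-- For `h` homogeneous of degree `d`, the restriction of `h` to the line `t ↦ t • e` is the
monomial `h(e) · t^d`: `aeval (fun i => C (e i) * X) h = C (eval e h) * X ^ d`. [folklore] -/
theorem aeval_C_mul_X_of_isHomogeneous {σ R : Type*} [CommSemiring R] {d : ℕ}
    {h : MvPolynomial σ R} (hh : h.IsHomogeneous d) (e : σ → R) :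
    MvPolynomial.aeval (fun i => Polynomial.C (e i) * Polynomial.X) h
      = Polynomial.C (MvPolynomial.eval e h) * Polynomial.X ^ d := by
  rw [MvPolynomial.aeval_def, MvPolynomial.eval₂_eq, MvPolynomial.eval_eq, map_sum,
    Finset.sum_mul]
  refine Finset.sum_congr rfl fun m hm => ?_
  rw [← Polynomial.C_eq_algebraMap, hh.degree_eq_sum_deg_support hm]
  simp only [mul_pow, Finset.prod_mul_distrib, Finset.prod_pow_eq_pow_sum, map_mul, map_prod,
    map_pow, mul_assoc]

/-- `Rank_h 0 = 0`: for `h` homogeneous of degree `d` with `h(e) ≠ 0`, the univariate polynomial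
`t ↦ h(0 + t e) = h(e) t^d` has order exactly `d` at `t = 0`. [folklore] -/
theorem natTrailingDegree_aeval_zero_add_of_isHomogeneous {σ R : Type*} [CommSemiring R] {d : ℕ}
    {h : MvPolynomial σ R} (hh : h.IsHomogeneous d) {e : σ → R} (he : MvPolynomial.eval e h ≠ 0) :
    (MvPolynomial.aeval (fun i => Polynomial.C ((0 : σ → R) i) + Polynomial.C (e i) * Polynomial.X)
      h).natTrailingDegree = d := by
  simp only [Pi.zero_apply, map_zero, zero_add]
  rw [aeval_C_mul_X_of_isHomogeneous hh e, Polynomial.C_mul_X_pow_eq_monomial,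
    Polynomial.natTrailingDegree_monomial he]

/-- A sub-additive `ℕ`-valued function vanishing at `0`, bounded by `k` on each of `r` summands,
is at most `k · r` on their sum. [folklore] -/
theorem le_mul_card_of_subadditive {M : Type*} [AddCommMonoid M] (f : M → ℕ) (h0 : f 0 = 0)
    (hadd : ∀ x y, f (x + y) ≤ f x + f y) {r k : ℕ} (x : Fin r → M) (hx : ∀ j, f (x j) ≤ k) :
    f (∑ j, x j) ≤ k * r := by
  calc f (∑ j, x j) ≤ ∑ j, f (x j) := Finset.le_sum_of_subadditive f h0.le hadd _ _
    _ ≤ ∑ _j : Fin r, k := Finset.sum_le_sum fun j _ => hx j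
    _ = k * r := by simp [mul_comm]

/-- **Support item `HypSoundness` of route HyperbolicRankMethods** (stmt-MatrixMultiplication-10090),
exact route decl: for finite index types and any `(h, e, Φ, k)` with `h` homogeneous of degree `d`,
`h(e) ≠ 0`, Gårding rank `w ↦ d − ord_{t=0} h(w + t e)` sub-additive on `ℝ^N` and `≤ k` on
`Φ`(rank-one tensors), every tensor `t` has `Rank_h(Φ t) ≤ k · R(t)`. [folklore]
[cite: Blaser2013, §4] -/
theorem hypSoundness_proof :
    Summit.MatrixMultiplication.MatrixMultiplication.Theses.HyperbolicRankMethods.HypSoundness := by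
  unfold Summit.MatrixMultiplication.MatrixMultiplication.Theses.HyperbolicRankMethods.HypSoundness
  intro ι κ μ _ _ _ N d k h e Φ hhom he hsub hone t
  -- the Gårding rank `w ↦ d − ord_{t=0} h(w + t e)`
  set GR : (Fin N → ℝ) → ℕ := fun w => d - (MvPolynomial.aeval
    (fun i => Polynomial.C (w i) + Polynomial.C (e i) * Polynomial.X) h).natTrailingDegree with hGR
  have h0 : GR 0 = 0 := by
    simp only [hGR, natTrailingDegree_aeval_zero_add_of_isHomogeneous hhom he, Nat.sub_self]
  obtain ⟨w, u, v, ht⟩ := exists_triad_decomposition_tensorRank t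
  have hΦt : Φ t = ∑ j, Φ (triad (w j) (u j) (v j)) := by
    rw [← map_sum]
    exact congrArg Φ ht
  change GR (Φ t) ≤ k * tensorRank t
  rw [hΦt]
  exact le_mul_card_of_subadditive GR h0 hsub (fun j => Φ (triad (w j) (u j) (v j)))
    fun j => hone (w j) (u j) (v j)

end Summit.MatrixMultiplication.MatrixMultiplication.Theorems
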